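import Summits.NavierStokesRegularity.NavierStokesRegularity.Theses.LevelSetModeration

/-!
# Route LevelSetModeration — a necessary condition carried by `HighSpeedPressureWork`

Support file for item stmt-NavierStokesRegularity-18149 (`HighSpeedPressureWork`, the improvement
step of the level-set iteration). Combined with the route's level-set energy inequality
(`LevelSetEnergyInequality`, Vasseur 2007 Lemma 11 globalised for the speed), the pressure-work
bound of the crux forces a **pressure-free** inequality on every classical Leray–Hopf solution of
the data class: for every level `c ∈ [M/2, M]`, `M ≥ 2B₀`,

  `ν · D_c(T) ≤ (F(E₀,B₀) M^m V_c(T))^{1/2} · D_c(T)^{1/2}`, hence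
  `ν² · D_c(T) ≤ F(E₀,B₀)⁺ · M^m · V_c(T)`,

where `D_c(T) = ∫₀ᵀ∫ 1_{|u|>c} |∇|u||²` is the level-set dissipation of the speed and
`V_c(T) = ∫₀ᵀ |{|u|>c}|` the space-time measure of the super-level set: the mean-square gradient of
the speed over a high-speed set is bounded by the data modulus times `M^m / ν²`. (The level-set
energy inequality gives `ν D_c(t) ≤ PW_c(t)` for every `t < T`; the crux bounds `PW_c(t)` by the
right-hand side at time `T`; continuity from below of the lower Lebesgue integral passes to
`t ↑ T`.) This isolates what a refutation of the crux has to exhibit (dissipation concentration on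
high-speed sets at fixed data bounds) without any reference to the pressure.

## References
* A. F. Vasseur, NoDEA 14 (2007), Lemma 11, Conj. 14. [Vasseur2007]
-/

noncomputable section

-- single-conjunct summit: `Summit.<Summit>.<Problem>` repeats the name by the D-0017 layout
set_option linter.dupNamespace false

namespace Summit.NavierStokesRegularity.NavierStokesRegularity.Theorems

open MeasureTheory Set Filter Topology
open scoped ENNReal
open Summit.NavierStokesRegularity.NavierStokesRegularity.Theses.LevelSetModeration

/-- **Passing a real bound through a supremum of lower Lebesgue integrals.** If `Λ = ⨆ₙ Lₙ` in
`ℝ≥0∞` and every *finite* `Lₙ` has `Lₙ.toReal ≤ R` (`R ≥ 0`), then `Λ.toReal ≤ R` (when `Λ = ∞`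
the left side is the junk value `0`). [folklore] -/
theorem levelSetModeration_toReal_iSup_le {L : ℕ → ℝ≥0∞} {Λ : ℝ≥0∞} (hΛ : Λ = ⨆ n, L n)
    {R : ℝ} (hR : 0 ≤ R) (h : ∀ n, L n ≠ ∞ → (L n).toReal ≤ R) : Λ.toReal ≤ R := by
  rcases eq_or_ne Λ ∞ with htop | htop
  · rw [htop, ENNReal.toReal_top]
    exact hR
  · have hle : ∀ n, L n ≤ Λ := fun n => hΛ ▸ le_iSup L n
    have hfin : ∀ n, L n ≠ ∞ := fun n => ne_top_of_le_ne_top htop (hle n)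
    have hbound : Λ ≤ ENNReal.ofReal R := by
      rw [hΛ]
      exact iSup_le fun n => (ENNReal.le_ofReal_iff_toReal_le (hfin n) hR).2 (h n (hfin n))
    exact ENNReal.toReal_le_of_le_ofReal hR hbound

/-- **Exhaustion of `(0, T)` by `(0, T(n+1)/(n+2))`**: the lower Lebesgue integral over `(0, T)`
is the supremum of the integrals over the increasing intervals `(0, tₙ)`, `tₙ = T(n+1)/(n+2)`
(Mathlib `setLIntegral_iUnion_of_directed`; no measurability needed). [folklore] -/
theorem levelSetModeration_lintegral_Ioo_eq_iSup {T : ℝ} (hT : 0 < T) (f : ℝ → ℝ≥0∞) :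
    ∫⁻ τ in Ioo 0 T, f τ = ⨆ n : ℕ, ∫⁻ τ in Ioo 0 (T * (n + 1) / (n + 2)), f τ := by
  have hmono : Monotone fun n : ℕ => Ioo (0 : ℝ) (T * (n + 1) / (n + 2)) := by
    intro a b hab
    refine Ioo_subset_Ioo le_rfl ?_
    have ha : (0 : ℝ) < (a : ℝ) + 2 := by positivity
    have hb : (0 : ℝ) < (b : ℝ) + 2 := by positivity
    rw [div_le_div_iff₀ ha hb]
    have hab' : (a : ℝ) ≤ b := Nat.cast_le.2 hab
    nlinarith
  have hU : (⋃ n : ℕ, Ioo (0 : ℝ) (T * (n + 1) / (n + 2))) = Ioo 0 T := by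
    ext τ
    simp only [mem_iUnion, mem_Ioo]
    constructor
    · rintro ⟨n, h0, h1⟩
      refine ⟨h0, h1.trans_le ?_⟩
      have hn : (0 : ℝ) < (n : ℝ) + 2 := by positivity
      rw [div_le_iff₀ hn]
      nlinarith
    · rintro ⟨h0, h1⟩
      -- choose `n` with `T/(n+2) < T - τ`
      obtain ⟨n, hn⟩ := exists_nat_gt (T / (T - τ))
      refine ⟨n, h0, ?_⟩
      have hTτ : 0 < T - τ := sub_pos.2 h1
      have hn2 : (0 : ℝ) < (n : ℝ) + 2 := by positivity
      rw [lt_div_iff₀ hn2]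
      have h2 : T < (T - τ) * ((n : ℝ) + 2) := by
        rw [div_lt_iff₀ hTτ] at hn
        nlinarith
      nlinarith
  rw [← hU]
  exact setLIntegral_iUnion_of_directed _ hmono.directed_le

/-- **Necessary condition carried by the crux `HighSpeedPressureWork`.** Assume the route's
level-set energy inequality `LevelSetEnergyInequality` (Vasseur 2007, Lemma 11 globalised for the
speed) and the crux `HighSpeedPressureWork`. Then for every `ν, T > 0`, with the same `m < 10/3`
and modulus `F` as the crux, every classical Leray–Hopf solution on `ℝ³ × [0,T)` from a rapidly
decaying datum with `∫|u₀|² ≤ E₀`, `|u₀| ≤ B₀` satisfies, for all `M ≥ 2B₀`, `c ∈ [M/2, M]`,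
`c > 0`: `ν · D_c(T) ≤ √(F(E₀,B₀) M^m V_c(T)) · √(D_c(T))` and
`ν² · D_c(T) ≤ max(F(E₀,B₀), 0) · M^m · V_c(T)`, where
`D_c(T) = ∫₀ᵀ∫ 1_{|u|>c} |∇|u||²` and `V_c(T) = ∫₀ᵀ |{|u|>c}|` (as `toReal` of lower Lebesgue
integrals, exactly as in the crux). Proof: the energy inequality gives `2ν D_c(t) ≤ 2 PW_c(t)` for
`t < T` (its kinetic term is `≥ 0`), the crux bounds `PW_c(t)` by the right side at `T`, and
`D_c(T) = sup_{t<T} D_c(t)` by continuity from below. [cite: Vasseur2007, Lemma 11 and Conj. 14] -/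
theorem levelSetModeration_highSpeedDissipation_le :
    Summit.NavierStokesRegularity.NavierStokesRegularity.Theses.LevelSetModeration.LevelSetEnergyInequality → Summit.NavierStokesRegularity.NavierStokesRegularity.Theses.LevelSetModeration.HighSpeedPressureWork → ∀ (ν T : ℝ), 0 < ν → 0 < T → ∃ m : ℝ, m < 10 / 3 ∧ ∃ F : ℝ → ℝ → ℝ, ∀ (u : ℝ → EuclideanSpace ℝ (Fin 3) → EuclideanSpace ℝ (Fin 3)) (p : ℝ → EuclideanSpace ℝ (Fin 3) → ℝ), Literature.Analysis.FluidPDE.IsClassicalNSSolutionOn (Set.Ico 0 T) ν 0 u p → Literature.Analysis.FluidPDE.IsLerayHopfOn T ν 0 (u 0) u → Literature.Analysis.FluidPDE.HasRapidSpatialDecay (u 0) → ∀ (E₀ B₀ : ℝ), (∫ x, ‖u 0 x‖ ^ 2) ≤ E₀ → (∀ x, ‖u 0 x‖ ≤ B₀) → ∀ (M c : ℝ), 2 * B₀ ≤ M → M / 2 ≤ c → c ≤ M → 0 < c → ν * (∫⁻ τ in Set.Ioo 0 T, ∫⁻ x, Set.indicator {x | c < ‖u τ x‖} (fun x => ENNReal.ofReal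 (‖fderiv ℝ (fun y => ‖u τ y‖) x‖ ^ 2)) x).toReal ≤ Real.sqrt (F E₀ B₀ * M ^ m * (∫⁻ τ in Set.Ioo 0 T, MeasureTheory.volume {x | c < ‖u τ x‖}).toReal) * Real.sqrt ((∫⁻ τ in Set.Ioo 0 T, ∫⁻ x, Set.indicator {x | c < ‖u τ x‖} (fun x => ENNReal.ofReal (‖fderiv ℝ (fun y => ‖u τ y‖) x‖ ^ 2)) x).toReal) ∧ ν ^ 2 * (∫⁻ τ in Set.Ioo 0 T, ∫⁻ x, Set.indicator {x | c < ‖u τ x‖} (fun x => ENNReal.ofReal (‖fderiv ℝ (fun y => ‖u τ y‖) x‖ ^ 2)) x).toReal ≤ max (F E₀ B₀) 0 * M ^ m * (∫⁻ τ in Set.Ioo 0 T, MeasureTheory.volume {x | c < ‖u τ x‖}).toReal := by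
  intro hE hW ν T hν hT
  obtain ⟨m, hm, F, hF⟩ := hW ν T hν hT
  refine ⟨m, hm, F, fun u p hcl hLH hdec E₀ B₀ hE₀ hB₀ M c hM hMc hcM hc => ?_⟩
  -- notation
  set f : ℝ → ℝ≥0∞ := fun τ => ∫⁻ x, Set.indicator {x | c < ‖u τ x‖}
      (fun x => ENNReal.ofReal (‖fderiv ℝ (fun y => ‖u τ y‖) x‖ ^ 2)) x with hf_def
  set D : ℝ := (∫⁻ τ in Set.Ioo 0 T, f τ).toReal with hD_def
  set V : ℝ := (∫⁻ τ in Set.Ioo 0 T, volume {x | c < ‖u τ x‖}).toReal with hV_def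
  set R : ℝ := Real.sqrt (F E₀ B₀ * M ^ m * V) * Real.sqrt D with hR_def
  have hR0 : 0 ≤ R := mul_nonneg (Real.sqrt_nonneg _) (Real.sqrt_nonneg _)
  -- the level `c` is above the initial speed maximum
  have hc0 : ∀ x, ‖u 0 x‖ ≤ c := fun x => by linarith [hB₀ x]
  -- Step 1: for every `t < T`, `ν D_c(t) ≤ R`
  have hstep : ∀ t ∈ Set.Ico 0 T, ν * (∫⁻ τ in Set.Ioo 0 t, f τ).toReal ≤ R := by
    intro t ht
    have h1 := hE ν T hν hT u p hcl hLH hdec c hc hc0 t ht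
    have h2 := hF u p hcl hLH hdec E₀ B₀ hE₀ hB₀ M c t hM hMc hcM hc ht
    have hX : 0 ≤ ∫ x, (max (‖u t x‖ - c) 0) ^ 2 := integral_nonneg fun x => sq_nonneg _
    have h3 : 2 * ν * (∫⁻ τ in Set.Ioo 0 t, f τ).toReal ≤ 2 * R := by
      have := h1
      linarith
    linarith
  -- Step 2: pass to `t ↑ T`
  have hsup := levelSetModeration_lintegral_Ioo_eq_iSup hT f
  have hDle : D ≤ R / ν := by
    refine levelSetModeration_toReal_iSup_le hsup (div_nonneg hR0 hν.le) fun n _ => ?_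
    have hn2 : (0 : ℝ) < (n : ℝ) + 2 := by positivity
    have ht : T * (n + 1) / (n + 2) ∈ Set.Ico 0 T := by
      refine ⟨by positivity, ?_⟩
      rw [div_lt_iff₀ hn2]
      nlinarith
    have := hstep _ ht
    rw [le_div_iff₀ hν]
    linarith
  have hmain : ν * D ≤ R := by
    have := mul_le_mul_of_nonneg_left hDle hν.le
    rwa [mul_div_cancel₀ _ hν.ne'] at this
  refine ⟨hmain, ?_⟩
  -- Step 3: the squared, `√`-free form
  have hD0 : 0 ≤ D := ENNReal.toReal_nonneg
  have hV0 : 0 ≤ V := ENNReal.toReal_nonneg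
  have hMpos : 0 < M := lt_of_lt_of_le hc hcM
  have hMm : 0 ≤ M ^ m := Real.rpow_nonneg hMpos.le m
  have hrhs0 : 0 ≤ max (F E₀ B₀) 0 * M ^ m * V := by positivity
  rcases eq_or_lt_of_le hD0 with hD00 | hDpos
  · rw [← hD00, mul_zero]
    exact hrhs0
  · -- `ν √D ≤ √(F M^m V)` after dividing by `√D > 0`
    have hsqD : 0 < Real.sqrt D := Real.sqrt_pos.2 hDpos
    have h1 : ν * Real.sqrt D ≤ Real.sqrt (F E₀ B₀ * M ^ m * V) := by
      have h2 : ν * Real.sqrt D * Real.sqrt D ≤ Real.sqrt (F E₀ B₀ * M ^ m * V) * Real.sqrt D := by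
        rw [mul_assoc, Real.mul_self_sqrt hD0]
        exact hmain
      exact le_of_mul_le_mul_right h2 hsqD
    have h3 : (ν * Real.sqrt D) ^ 2 ≤ (Real.sqrt (F E₀ B₀ * M ^ m * V)) ^ 2 :=
      pow_le_pow_left₀ (by positivity) h1 2
    rw [mul_pow, Real.sq_sqrt hD0] at h3
    refine h3.trans ?_
    rcases le_or_gt 0 (F E₀ B₀ * M ^ m * V) with hpos | hneg
    · rw [Real.sq_sqrt hpos]
      gcongr
      exact le_max_left _ _
    · rw [Real.sqrt_eq_zero'.2 hneg.le, zero_pow two_ne_zero]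
      exact hrhs0

end Summit.NavierStokesRegularity.NavierStokesRegularity.Theorems
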